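import Literature.IUT.HodgeTheaters.PiAvatarKitCoreTheta
import Literature.IUT.HodgeTheaters.PiAvatarKitCoreGluing
import HarnessLib

/-!
# [IUTchI] Rmk 6.12.2 (ii) / Def 6.13 (i)(c), (ii)(c) AT THE GENUINE Θ-NF STAND-IN KIT: the gluing of a `Θ^{±ell}`-Hodge theater and a
# `ΘNF`-Hodge theater along their `𝒟`-prime-strips is UNIQUE — FACT-LIST F-2049 `GluingUnique`, F-2682 `GluingUniqueBad` at the NAMED INSTANCE
# `baseKitThetaNFStandIn` of the REAL initial Θ-data over abc-iut-L5-t4's NAMED core `kitCoreThetaStandIn ES` (D-JΘ1-2 «KITCORE-THETA-GLUING»;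
# proof-only; post-freeze additive, not a cone member)

S. Mochizuki, *Inter-universal Teichmüller theory I*, kurims manuscript (May 2020), Rmk 6.12.2 (ii) p. 174 («by Proposition 4.8, (ii); Corollary 5.6,
(ii), the gluing isomorphism that occurs in such a gluing operation is unique»), Def 6.13 (i)(c) p. 182 («the [necessarily unique!] gluing isomorphism
between `†ℋ𝒯^{Θ±ell}` and `†ℋ𝒯^{ΘNF}`»), (ii)(c) p. 183, Prop 6.7 p. 167, Def 3.1 (b)(c) p. 62. ([IUTchI] Rmk 6.12.2 (ii) p.174) [claim: Mochizuki2012,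
status: disputed] (D-0012 claim key, series status DISPUTED — kernel theorems over abc-iut-L5-t2's REAL `InitialThetaData`, abc-iut-L5-t4's Θ-NF
stand-in kit `baseKitThetaNFStandIn` / core `kitCoreThetaStandIn` (`PiAvatarKitCoreTheta`) and abc-iut-L5-t5's ΘNF-side kit interface `S5Local`;
nothing of the series is asserted, no side is taken on [IUTchIII] Cor. 3.12).

WHAT (L5-lead RULINGS #89 (2) / #90 (1)(d), pre-authorised «KITCORE-THETA-GLUING»; this is abc-iut-L5-t3's `PiAvatarKitCoreGluing` (p453062) RE-RUN with
the Π-avatar binder `Ev`/`Mk`/`Z`/`hne`/`hrig`/`hsat` REPLACED by the evaluation-section binder `ES`).  At the D13 Π-avatar kit the §4 datum behind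
p453062 is VACUOUS at closed `Π_v̲` (abc-iut-w4-d054 p456090); over the transporter-or-degenerate ambient `ThetaAmb` (abc-iut-L5-t4 p462621, D-JΘ1-2)
the frozen `EvalBinder`/`KitCore` are INHABITED from abc-iut-L5-t3's `EvalSectionBinder` family `ES` (abc-iut-L5-t4 `evalBinderThetaNFStandIn`,
`kitCoreThetaStandIn`, law (γ) `thetaAgrees_thetaStandIn`, with `N := nfKitThetaStandIn` of abc-iut-L5-t3 (D′)).  Hence abc-iut-L5-t3's
`KitCore.gluingUnique` / `gluingUniqueBad` / `dGluing_subsingleton` (KitCoreBridge, label-rigidity route) give, for EVERY `F`-kit `FK` and EVERY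
ΘNF-side kit `N : S5Local (multKitThetaNFStandIn … ES) FK` over `baseKitThetaNFStandIn`: **`gluingUnique_thetaStandIn`** (F-2049),
**`gluingUniqueBad_thetaStandIn`** (F-2682), **`dGluing_subsingleton_thetaStandIn`** (Def 6.13 (ii)(c)), with `Odd l` from Def 3.1 (c) (`odd_l`, p453062)
and the bad place from Def 3.1 (b) (`indexCopyBad_nonempty`).  DISPLAYED BINDERS, exhaustively: {`CG`, `hS`, `M`, `hA`, `hI`} (kit) ∪ {`ES`} (abc-iut-L5-t3's
`EvalSectionBinder` family at `localDataStandIn` — a LAW binder until row «EVALSECT-NV» lands) ∪ the universally quantified `FK`, `N`; `N`-side NF kit and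
`B` are TERMS.  HONEST TAG: «instance forms at OUR Θ-NF ambient (ThetaAmb: ¬IsIso by tag; PRICE IN FAITHFULNESS recorded in p462621's docstring);
NV of `ES` pending (EVALSECT-NV)»; a stand-in witnesses OUR binders only and is NOT print's tempered `ℬ^temp(X̳_v̲)⁰`.  Proof-only; no instance, no
notation; typed ≠ inhabited ≠ proved; binder ≠ fact.
-/

noncomputable section

namespace Literature.IUT.HodgeTheaters

open CategoryTheory

universe u v w

section KitCoreThetaGluing

variable {F : Type u} {K : Type v} {Fbar : Type w} [Field F] [NumberField F] [Field K] [NumberField K]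
  [Algebra F K] [Field Fbar] [Algebra F Fbar] [Algebra K Fbar]
  {E : WeierstrassCurve F} [E.IsElliptic] {l : ℕ} {Pb : BadPlacePredicates K}
  (D : InitialThetaData F K Fbar E l Pb) (CG : D.geom.pe.CuspGalois) (hS : D.CuspClassesNormaliserStable) [Fact l.Prime]
  (M : D.TorsionMonodromy) (hA : D.geom.pe.ArrowCoveringClaims)
  (hI : ∀ k ∈ D.geom.pe.inertia D.geom.pe.ε1, M.tau (D.geom.embK k) = 0)

namespace InitialThetaData

variable {Gv : D.IndexCopy → Subgroup (Fbar ≃ₐ[F] Fbar)}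
  (ES : ∀ v, v ∈ D.indexCopyBad → EvalSectionBinder (D.localDataStandIn CG hS M hA hI v) (Gv v))

/-- **F-2049 `GluingUnique` AT THE GENUINE Θ-NF STAND-IN KIT** ([IUTchI] Rmk 6.12.2 (ii) / Def 6.13 (i)(c): the gluing of `†ℋ𝒯^{Θ±ell}` and
`†ℋ𝒯^{ΘNF}` is unique): for EVERY `F`-kit `FK` and EVERY ΘNF-side kit `N` over the Θ-NF stand-in base kit of the real initial Θ-data and the
multiplicative kit generated by the evaluation sections `ES` — via abc-iut-L5-t4's core `kitCoreThetaStandIn ES` and law (γ) `thetaAgrees_thetaStandIn`.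
([IUTchI] Rmk 6.12.2 (ii) p.174) [claim: Mochizuki2012, status: disputed] -/
theorem gluingUnique_thetaStandIn
    {FK : (D.baseKitThetaNFStandIn CG hS M hA hI).FKit (D.multKitThetaNFStandIn CG hS M hA hI ES)}
    (N : (D.baseKitThetaNFStandIn CG hS M hA hI).S5Local (D.multKitThetaNFStandIn CG hS M hA hI ES) FK) :
    N.GluingUnique D.odd_l := by
  obtain ⟨x, hx⟩ := D.indexCopyBad_nonempty
  exact BaseThetaDatum.KitCore.gluingUnique (D.thetaAgrees_thetaStandIn CG hS M hA hI ES) D.odd_l N hx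

/-- **F-2682 `GluingUniqueBad` AT THE GENUINE Θ-NF STAND-IN KIT** (abc-iut-L5-t5's guarded form `𝕍^bad ≠ ∅ → GluingUnique`).
([IUTchI] Rmk 6.12.2 (ii) p.174) [claim: Mochizuki2012, status: disputed] -/
theorem gluingUniqueBad_thetaStandIn
    {FK : (D.baseKitThetaNFStandIn CG hS M hA hI).FKit (D.multKitThetaNFStandIn CG hS M hA hI ES)}
    (N : (D.baseKitThetaNFStandIn CG hS M hA hI).S5Local (D.multKitThetaNFStandIn CG hS M hA hI ES) FK) :
    N.GluingUniqueBad D.odd_l :=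
  BaseThetaDatum.KitCore.gluingUniqueBad (D.thetaAgrees_thetaStandIn CG hS M hA hI ES) D.odd_l N

/-- **[IUTchI] Def 6.13 (ii)(c) AT THE GENUINE Θ-NF STAND-IN KIT**: the `𝒟`-level gluing of a `𝒟-ΘNF`-Hodge theater to a `𝒟-Θ^±`-bridge via
Proposition 6.7 is unique. ([IUTchI] Def 6.13 (ii) p.183) [claim: Mochizuki2012, status: disputed] -/
theorem dGluing_subsingleton_thetaStandIn
    {FK : (D.baseKitThetaNFStandIn CG hS M hA hI).FKit (D.multKitThetaNFStandIn CG hS M hA hI ES)}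
    (N : (D.baseKitThetaNFStandIn CG hS M hA hI).S5Local (D.multKitThetaNFStandIn CG hS M hA hI ES) FK)
    (B : (D.baseKitThetaNFStandIn CG hS M hA hI).DThetaPMBridge) (X : N.DNFHT) :
    Subsingleton (N.DThetaGluing B X D.odd_l) := by
  obtain ⟨x, hx⟩ := D.indexCopyBad_nonempty
  exact BaseThetaDatum.KitCore.dGluing_subsingleton (D.thetaAgrees_thetaStandIn CG hS M hA hI ES) D.odd_l N hx B X

/-- **Rmk 6.12.2 (ii), comparison of index sets onto**: `GluingUnique` also holds outright through the SURJECTIVITY of the core's index comparison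
(`kitCoreThetaStandIn_e`: the identity), the bad place being supplied by Def 3.1 (b). ([IUTchI] Rmk 6.12.2 (ii) p.174) [claim: Mochizuki2012, status: disputed] -/
theorem gluingUnique_thetaStandIn_of_surjective
    {FK : (D.baseKitThetaNFStandIn CG hS M hA hI).FKit (D.multKitThetaNFStandIn CG hS M hA hI ES)}
    (N : (D.baseKitThetaNFStandIn CG hS M hA hI).S5Local (D.multKitThetaNFStandIn CG hS M hA hI ES) FK) :
    N.GluingUnique D.odd_l :=
  BaseThetaDatum.KitCore.gluingUnique_of_surjective (D.thetaAgrees_thetaStandIn CG hS M hA hI ES) (fun x => ⟨x, rfl⟩) D.odd_l N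

end InitialThetaData

end KitCoreThetaGluing

end Literature.IUT.HodgeTheaters
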